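import Literature.Analysis.FluidPDE.TypeIAncientMild
import Literature.Analysis.FluidPDE.OseenDuhamelPairCalculus
import Literature.Analysis.FluidPDE.MildSolutionProofs
import HarnessLib

/-!
# Route ClockStretchingLaw, crux `ClockCeiling` (stmt-NavierStokesRegularity-10570) — the
# L∞ FORWARD SMALLNESS WINDOW of the Type-I ancient class

Engine of the lead-c6 portrait clauses of the crux's Type-I class (`IsTypeIAncientMild C u`:
jointly smooth on `(−∞,0) × ℝ³`, divergence-free, KNSS/Oseen-mild between every pair of times,
`‖u(t,x)‖ ≤ C/√(−t)`):

**`stub_forwardSmallnessWindow`.** If a slice is small, `‖u(t₀, ·)‖_∞ ≤ m` (`m > 0`), then the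
sup norm at most doubles, `‖u(t, ·)‖_∞ ≤ 2m`, for as long as `16 C₀ m √(t − t₀) ≤ 1`
(`C₀ = oseenSliceConst`, the constant of the Oseen slice bound `‖N_σ[a,b]‖_∞ ≤ C₀σ^{-1/2}‖a‖‖b‖`).

This is the a-priori half of the `L^∞` local well-posedness of Koch–Nadirashvili–Seregin–Šverák
(2009, §4: `u = U + B(u,u)`, `‖B(u,v)‖ ≤ C√T‖u‖‖v‖`) run on the given solution by the continuity
method: no fixed point and no uniqueness theorem is needed, only the Oseen identity from `t₀`
(`IsTypeIAncientMild.mild_eq`), the caloric bound `‖e^{σΔ}a‖_∞ ≤ ‖a‖_∞` (`norm_heatFlow_le`), the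
Abel bound of the Duhamel term with time-dependent slice bounds (`norm_oseenDuhamel_le_setIntegral`)
and the a-priori Type-I bound `C/√(−T)` on the short stretch beyond the bootstrap time, which is
what makes the bootstrap set open to the right (`IsClosed.Icc_subset_of_forall_mem_nhdsWithin`).

Consequences (sibling file `ClockStretchingLawClockCeilingLerayFloor.lean`): the universal Leray floor
`√(−t)‖u(t)‖_∞ > 1/(32C₀)` of singular Type-I models at every time, and the liminf far-past
Liouville theorem (smallness along one sequence `t_k → −∞` forces `u ≡ 0`).

## References

* G. Koch, N. Nadirashvili, G. Seregin, V. Šverák, *Liouville theorems for the Navier–Stokes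
  equations and applications*, Acta Math. 203 (2009) 83–105 = arXiv:0709.3599, §4 p. 8.
  [KochNadirashviliSereginSverak2009]
* J. Leray, Acta Math. 63 (1934), §19–20 (the lower bound on the blow-up rate). [Leray1934]
-/

noncomputable section

-- the summit and its single sub-problem share the name (CONVENTIONS §1), as in every Theorems file
set_option linter.dupNamespace false

open MeasureTheory Set Filter Topology
open Literature.Analysis Literature.Analysis.FluidPDE

namespace Summit.NavierStokesRegularity.NavierStokesRegularity.Theorems

/-- **One continuity step of the forward smallness window.** If `‖u(t₀)‖_∞ ≤ m`, the bootstrap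
bound `‖u‖ ≤ 2m` holds on `[t₀, t]`, and `16 C₀ m √(T − t₀) ≤ 1` with `T < 0`, then the
bootstrap bound persists on a short stretch `(t, t + δ)` (as far as `T`): the Oseen identity from
`t₀` gives `‖u(τ)‖ ≤ m + C₀(8m²√(τ − t₀) + 2B²√(τ − t))`, `B = C/√(−T)` the a-priori bound beyond `t`.
[cite: KochNadirashviliSereginSverak2009, §4 p. 8 (arXiv:0709.3599)] -/
theorem forwardSmallnessWindow_step {C : ℝ} {u : ℝ → (EuclideanSpace ℝ (Fin 3)) → (EuclideanSpace ℝ (Fin 3))} (h : IsTypeIAncientMild C u)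
    {t₀ m T t : ℝ} (ht₀t : t₀ ≤ t) (hT : T < 0) (hm : 0 < m)
    (h0 : ∀ x, ‖u t₀ x‖ ≤ m)
    (hwin : 16 * oseenSliceConst (EuclideanSpace ℝ (Fin 3)) * m * Real.sqrt (T - t₀) ≤ 1)
    (hboot : ∀ τ ∈ Icc t₀ t, ∀ x, ‖u τ x‖ ≤ 2 * m) :
    ∃ δ > 0, ∀ τ ∈ Ioo t (t + δ), τ ≤ T → ∀ x, ‖u τ x‖ ≤ 2 * m := by
  have hC : 0 ≤ C := h.nonneg
  have hC₀ : 0 < oseenSliceConst (EuclideanSpace ℝ (Fin 3)) := oseenSliceConst_pos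
  set B : ℝ := C / Real.sqrt (-T) with hB
  have hsT : 0 < Real.sqrt (-T) := Real.sqrt_pos.2 (by linarith)
  have hB0 : 0 ≤ B := div_nonneg hC hsT.le
  -- `δ` with `2 C₀ B² √δ ≤ m / 2`
  set D : ℝ := 4 * oseenSliceConst (EuclideanSpace ℝ (Fin 3)) * B ^ 2 + 1 with hD
  have hD0 : 0 < D := by positivity
  set δ : ℝ := (m / D) ^ 2 with hδ
  have hmD : 0 < m / D := div_pos hm hD0
  have hδ0 : 0 < δ := by positivity
  refine ⟨δ, hδ0, fun τ hτ hτT x => ?_⟩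
  have htτ : t < τ := hτ.1
  have ht₀τ : t₀ < τ := lt_of_le_of_lt ht₀t htτ
  have hτ0 : τ < 0 := lt_of_le_of_lt hτT hT
  -- a-priori bound beyond `t`
  have hapriori : ∀ σ ∈ Ioo t τ, ∀ y, ‖u σ y‖ ≤ B := by
    intro σ hσ y
    have hσ0 : σ < 0 := hσ.2.trans hτ0
    refine (h.norm_le hσ0 y).trans ?_
    rw [hB]
    refine div_le_div_of_nonneg_left hC hsT (Real.sqrt_le_sqrt ?_)
    linarith [hσ.2]
  -- the slice-bound profile
  set M : ℝ → ℝ := fun σ => if σ ≤ t then 2 * m else B with hM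
  have hMmeas : Measurable M := by
    refine Measurable.ite measurableSet_Iic measurable_const measurable_const
  have hMbound : ∀ σ ∈ Ioo t₀ τ, ∀ y, ‖u σ y‖ ≤ M σ := by
    intro σ hσ y
    by_cases hσt : σ ≤ t
    · have : M σ = 2 * m := by simp [hM, hσt]
      rw [this]
      exact hboot σ ⟨hσ.1.le, hσt⟩ y
    · have : M σ = B := by simp [hM, hσt]
      rw [this]
      exact hapriori σ ⟨lt_of_not_ge hσt, hσ.2⟩ y
  have hMnn : ∀ σ, 0 ≤ M σ := by
    intro σ
    by_cases hσt : σ ≤ t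
    · simp [hM, hσt]; linarith
    · simp [hM, hσt]; exact hB0
  have hMle : ∀ σ, M σ ≤ 2 * m + B := by
    intro σ
    by_cases hσt : σ ≤ t
    · simp [hM, hσt]; exact hB0
    · simp [hM, hσt]; linarith
  -- the Abel kernel
  set k : ℝ → ℝ := fun σ => (τ - σ) ^ (-(1 / 2 : ℝ)) with hk
  have hkint : IntegrableOn k (Ioo t₀ τ) := integrableOn_sub_rpow_Ioo (by norm_num)
  have hknn : ∀ σ ∈ Ioo t₀ τ, 0 ≤ k σ := fun σ hσ =>
    Real.rpow_nonneg (by linarith [hσ.2]) _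
  -- integrability of `k · M²`
  have hint : IntegrableOn (fun σ => k σ * (M σ * M σ)) (Ioo t₀ τ) := by
    have hMM : AEStronglyMeasurable (fun σ => M σ * M σ) (volume.restrict (Ioo t₀ τ)) :=
      (hMmeas.mul hMmeas).aestronglyMeasurable
    have hbd : ∀ᵐ σ ∂(volume.restrict (Ioo t₀ τ)), ‖M σ * M σ‖ ≤ (2 * m + B) * (2 * m + B) := by
      refine Eventually.of_forall fun σ => ?_
      rw [Real.norm_eq_abs, abs_of_nonneg (mul_nonneg (hMnn σ) (hMnn σ))]
      exact mul_le_mul (hMle σ) (hMle σ) (hMnn σ) (by linarith [hMnn σ, hMle σ])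
    have := hkint.bdd_mul hMM hbd
    refine this.congr (Eventually.of_forall fun σ => ?_)
    ring
  -- the Duhamel bound
  have hduh := norm_oseenDuhamel_le_setIntegral (E := (EuclideanSpace ℝ (Fin 3))) (t₀ := t₀) (t := τ) (a := u) (b := u)
    hMbound hMbound hint x
  -- evaluate the Abel integral: split `(t₀, τ) = (t₀, t] ∪ (t, τ)`
  have hsplit : ∫ σ in Ioo t₀ τ, k σ * (M σ * M σ) =
      (∫ σ in Ioc t₀ t, k σ * (M σ * M σ)) + ∫ σ in Ioo t τ, k σ * (M σ * M σ) := by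
    rw [← Ioc_union_Ioo_eq_Ioo ht₀t htτ]
    refine setIntegral_union ?_ measurableSet_Ioo (hint.mono_set ?_) (hint.mono_set ?_)
    · exact Set.disjoint_left.2 fun σ h1 h2 => (not_lt.2 h1.2) h2.1
    · exact fun σ hσ => ⟨hσ.1, lt_of_le_of_lt hσ.2 htτ⟩
    · exact fun σ hσ => ⟨lt_of_le_of_lt ht₀t hσ.1, hσ.2⟩
  have hpart1 : ∫ σ in Ioc t₀ t, k σ * (M σ * M σ) ≤ (2 * m) * (2 * m) * (2 * Real.sqrt (τ - t₀)) := by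
    have e1 : ∫ σ in Ioc t₀ t, k σ * (M σ * M σ) = ∫ σ in Ioc t₀ t, (2 * m) * (2 * m) * k σ := by
      refine setIntegral_congr_fun measurableSet_Ioc fun σ hσ => ?_
      have : M σ = 2 * m := by simp [hM, hσ.2]
      rw [this]; ring
    rw [e1, integral_const_mul]
    refine mul_le_mul_of_nonneg_left ?_ (by positivity)
    calc ∫ σ in Ioc t₀ t, k σ ≤ ∫ σ in Ioo t₀ τ, k σ := by
          refine setIntegral_mono_set hkint ?_ (Eventually.of_forall ?_)
          · exact (ae_restrict_iff' measurableSet_Ioo).2 (Eventually.of_forall hknn)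
          · exact fun σ hσ => ⟨hσ.1, lt_of_le_of_lt hσ.2 htτ⟩
      _ = 2 * Real.sqrt (τ - t₀) := by
          rw [hk, setIntegral_Ioo_sub_rpow_neg_half ht₀τ.le, Real.sqrt_eq_rpow]
  have hpart2 : ∫ σ in Ioo t τ, k σ * (M σ * M σ) = B * B * (2 * Real.sqrt (τ - t)) := by
    have e1 : ∫ σ in Ioo t τ, k σ * (M σ * M σ) = ∫ σ in Ioo t τ, B * B * k σ := by
      refine setIntegral_congr_fun measurableSet_Ioo fun σ hσ => ?_
      have : M σ = B := by simp [hM, not_le.2 hσ.1]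
      rw [this]; ring
    rw [e1, integral_const_mul, hk, setIntegral_Ioo_sub_rpow_neg_half htτ.le, Real.sqrt_eq_rpow]
  -- the two smallness conditions
  have hsmall1 : oseenSliceConst (EuclideanSpace ℝ (Fin 3)) * ((2 * m) * (2 * m) * (2 * Real.sqrt (τ - t₀))) ≤ m / 2 := by
    have hsq : Real.sqrt (τ - t₀) ≤ Real.sqrt (T - t₀) := Real.sqrt_le_sqrt (by linarith)
    have : oseenSliceConst (EuclideanSpace ℝ (Fin 3)) * ((2 * m) * (2 * m) * (2 * Real.sqrt (τ - t₀)))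
        = (m / 2) * (16 * oseenSliceConst (EuclideanSpace ℝ (Fin 3)) * m * Real.sqrt (τ - t₀)) := by ring
    rw [this]
    have h16 : 16 * oseenSliceConst (EuclideanSpace ℝ (Fin 3)) * m * Real.sqrt (τ - t₀) ≤ 1 :=
      le_trans (by gcongr) hwin
    calc (m / 2) * (16 * oseenSliceConst (EuclideanSpace ℝ (Fin 3)) * m * Real.sqrt (τ - t₀)) ≤ (m / 2) * 1 := by
          exact mul_le_mul_of_nonneg_left h16 (by linarith)
      _ = m / 2 := by ring
  have hsmall2 : oseenSliceConst (EuclideanSpace ℝ (Fin 3)) * (B * B * (2 * Real.sqrt (τ - t))) ≤ m / 2 := by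
    have hτt : τ - t < δ := by linarith [hτ.2]
    have hsq : Real.sqrt (τ - t) ≤ m / D := by
      rw [← Real.sqrt_sq hmD.le]
      exact Real.sqrt_le_sqrt (by rw [← hδ]; exact hτt.le)
    calc oseenSliceConst (EuclideanSpace ℝ (Fin 3)) * (B * B * (2 * Real.sqrt (τ - t)))
        = (2 * oseenSliceConst (EuclideanSpace ℝ (Fin 3)) * B ^ 2) * Real.sqrt (τ - t) := by ring
      _ ≤ (2 * oseenSliceConst (EuclideanSpace ℝ (Fin 3)) * B ^ 2) * (m / D) :=
          mul_le_mul_of_nonneg_left hsq (by positivity)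
      _ ≤ m / 2 := by
          rw [hD]
          rw [mul_div_assoc']
          rw [div_le_div_iff₀ (by positivity) (by norm_num)]
          nlinarith [hC₀, sq_nonneg B, hm]
  -- assemble
  have hheat : ‖heatFlow (u t₀) (τ - t₀) x‖ ≤ m := norm_heatFlow_le h0 _ x
  rw [h.mild_eq ht₀τ hτ0 x]
  calc ‖heatFlow (u t₀) (τ - t₀) x - oseenDuhamel 1 t₀ u u τ x‖
      ≤ ‖heatFlow (u t₀) (τ - t₀) x‖ + ‖oseenDuhamel 1 t₀ u u τ x‖ := norm_sub_le _ _
    _ ≤ m + oseenSliceConst (EuclideanSpace ℝ (Fin 3)) * ∫ σ in Ioo t₀ τ, k σ * (M σ * M σ) := add_le_add hheat hduh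
    _ = m + oseenSliceConst (EuclideanSpace ℝ (Fin 3)) * ((∫ σ in Ioc t₀ t, k σ * (M σ * M σ)) +
          ∫ σ in Ioo t τ, k σ * (M σ * M σ)) := by rw [hsplit]
    _ ≤ m + oseenSliceConst (EuclideanSpace ℝ (Fin 3)) * ((2 * m) * (2 * m) * (2 * Real.sqrt (τ - t₀)) +
          B * B * (2 * Real.sqrt (τ - t))) := by
          gcongr
          rw [hpart2]
    _ = m + (oseenSliceConst (EuclideanSpace ℝ (Fin 3)) * ((2 * m) * (2 * m) * (2 * Real.sqrt (τ - t₀))) +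
          oseenSliceConst (EuclideanSpace ℝ (Fin 3)) * (B * B * (2 * Real.sqrt (τ - t)))) := by ring
    _ ≤ m + (m / 2 + m / 2) := by gcongr
    _ = 2 * m := by ring

/-- **Stub `stub_forwardSmallnessWindow` — the L∞ forward smallness window of the Type-I ancient
class.** For `u ∈ A_C` (`IsTypeIAncientMild C u`), a slice bound `‖u(t₀, ·)‖_∞ ≤ m` (`m > 0`)
at most doubles forward in time, `‖u(t, x)‖ ≤ 2m`, for every `t ∈ [t₀, 0)` with
`16 C₀ m √(t − t₀) ≤ 1` (`C₀ = oseenSliceConst`). Continuity method on the bootstrap set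
`{t | ‖u‖ ≤ 2m on [t₀, t]}`: it contains `t₀`, is closed (joint continuity of `u`), and is open to
the right (`forwardSmallnessWindow_step`). [cite: KochNadirashviliSereginSverak2009, §4 p. 8 (arXiv:0709.3599)] -/
theorem stub_forwardSmallnessWindow :
    ∀ (C : ℝ) (u : ℝ → EuclideanSpace ℝ (Fin 3) → EuclideanSpace ℝ (Fin 3)), Literature.Analysis.FluidPDE.IsTypeIAncientMild C u → ∀ (t₀ m : ℝ), t₀ < 0 → 0 < m → (∀ x, ‖u t₀ x‖ ≤ m) → ∀ t : ℝ, t₀ ≤ t → t < 0 → 16 * Literature.Analysis.FluidPDE.oseenSliceConst (EuclideanSpace ℝ (Fin 3)) * m * Real.sqrt (t - t₀) ≤ 1 → ∀ x, ‖u t x‖ ≤ 2 * m := by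
  intro C u h t₀ m ht₀ hm h0 T ht₀T hT hwin
  -- the bootstrap set
  set S : Set ℝ := {t | ∀ τ ∈ Icc t₀ t, ∀ x, ‖u τ x‖ ≤ 2 * m} with hS
  -- continuity of `s ↦ u s x` on `(-∞, 0)`
  have hcont : ∀ x, ContinuousOn (fun s => u s x) (Iio 0) := by
    intro x
    have hc := h.continuousOn_uncurry
    have hmap : MapsTo (fun s : ℝ => (s, x)) (Iio 0) (Iio 0 ×ˢ (univ : Set (EuclideanSpace ℝ (Fin 3)))) :=
      fun s hs => ⟨hs, mem_univ _⟩
    exact hc.comp ((continuous_id.prodMk continuous_const).continuousOn) hmap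
  have hsub : Icc t₀ T ⊆ S := by
    refine IsClosed.Icc_subset_of_forall_mem_nhdsWithin ?_ ?_ ?_
    · -- closedness of `S ∩ Icc t₀ T` through the `min` trick
      have hrepr : S ∩ Icc t₀ T =
          Icc t₀ T ∩ ⋂ τ ∈ Icc t₀ T, ⋂ x : (EuclideanSpace ℝ (Fin 3)), {t | ‖u (min τ t) x‖ ≤ 2 * m} := by
        ext t
        simp only [mem_inter_iff, mem_iInter, mem_setOf_eq, hS]
        constructor
        · rintro ⟨hall, htI⟩
          refine ⟨htI, fun τ hτ x => hall (min τ t) ⟨le_min hτ.1 htI.1, min_le_right _ _⟩ x⟩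
        · rintro ⟨htI, hall⟩
          refine ⟨fun τ hτ x => ?_, htI⟩
          have := hall τ ⟨hτ.1, hτ.2.trans htI.2⟩ x
          rwa [min_eq_left hτ.2] at this
      rw [hrepr]
      have hclosed : ∀ τ ∈ Icc t₀ T, ∀ x : (EuclideanSpace ℝ (Fin 3)),
          IsClosed (Icc t₀ T ∩ {t | ‖u (min τ t) x‖ ≤ 2 * m}) := by
        intro τ hτ x
        have hco : ContinuousOn (fun t => ‖u (min τ t) x‖) (Icc t₀ T) := by
          refine ContinuousOn.norm ?_
          have hmin : Continuous fun t : ℝ => min τ t := continuous_const.min continuous_id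
          refine (hcont x).comp hmin.continuousOn fun t ht => ?_
          exact lt_of_le_of_lt (min_le_right _ _ |>.trans ht.2) hT
        exact hco.preimage_isClosed_of_isClosed isClosed_Icc isClosed_Iic
      have : Icc t₀ T ∩ ⋂ τ ∈ Icc t₀ T, ⋂ x : (EuclideanSpace ℝ (Fin 3)), {t | ‖u (min τ t) x‖ ≤ 2 * m} =
          ⋂ τ ∈ Icc t₀ T, ⋂ x : (EuclideanSpace ℝ (Fin 3)), (Icc t₀ T ∩ {t | ‖u (min τ t) x‖ ≤ 2 * m}) := by
        ext t
        simp only [mem_inter_iff, mem_iInter, mem_setOf_eq]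
        constructor
        · rintro ⟨htI, hall⟩; exact fun τ hτ x => ⟨htI, hall τ hτ x⟩
        · intro hall
          exact ⟨(hall t₀ ⟨le_rfl, ht₀T⟩ 0).1, fun τ hτ x => (hall τ hτ x).2⟩
      rw [this]
      exact isClosed_biInter fun τ hτ => isClosed_iInter fun x => hclosed τ hτ x
    · -- `t₀ ∈ S`
      intro τ hτ x
      have : τ = t₀ := le_antisymm hτ.2 hτ.1
      rw [this]
      linarith [h0 x]
    · -- open to the right
      rintro t ⟨htS, htI⟩
      obtain ⟨δ, hδ, hstep⟩ := forwardSmallnessWindow_step h htI.1 hT hm h0 hwin htS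
      rw [mem_nhdsGT_iff_exists_Ioo_subset]
      refine ⟨min (t + δ) T, lt_min (by linarith) htI.2, fun t' ht' τ hτ x => ?_⟩
      by_cases hτt : τ ≤ t
      · exact htS τ ⟨hτ.1, hτt⟩ x
      · have ht'T : t' < T := lt_of_lt_of_le ht'.2 (min_le_right _ _)
        have ht'δ : t' < t + δ := lt_of_lt_of_le ht'.2 (min_le_left _ _)
        exact hstep τ ⟨lt_of_not_ge hτt, lt_of_le_of_lt hτ.2 ht'δ⟩ (hτ.2.trans ht'T.le) x
  exact fun x => hsub ⟨ht₀T, le_rfl⟩ T ⟨ht₀T, le_rfl⟩ x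

end Summit.NavierStokesRegularity.NavierStokesRegularity.Theorems

end
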